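import Mathlib
import Literature.Geometry.Symplectic.JHolomorphicMap
import Summits.SmoothPoincare4.SmoothPoincare4.Theorems.SullivanDualTameOrBrodyR4AprioriCalculus
import Summits.SmoothPoincare4.SmoothPoincare4.Theorems.SullivanDualTameOrBrodyR4AprioriSource
import Summits.SmoothPoincare4.SmoothPoincare4.Theorems.SullivanDualTameOrBrodyR4AprioriEnergy

/-!
# A-priori estimate for `J`-holomorphic maps: part 4, step α

Helper file of the lead (c2) for stub `stub_aprioriOf` of line `Sketch`, crux `TameOrBrodyR4`
(stmt-SmoothPoincare4-7826, route SullivanDual). Step α of the bootstrapping (registered sub-goal `alpha`): with the orders `≤ n - 2` frozen on a disc, one more derivative is bounded in `L²` on a smaller disc, `∫_{D_{ρ'}} ‖D^{n+1}g‖² ≤ C (1 + ∫_{D_ρ} ‖D^{n-1}g‖⁴ + ∫_{D_ρ} ‖Dⁿg‖²)`, with `C` independent of `g` (localised energy estimate for every word, commutator source bound, sum over the `2^{n+1}` words).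
-/

noncomputable section

open scoped ContDiff Topology Nat
open Filter Set Literature.Geometry.Symplectic

-- the registered namespace `Summit.SmoothPoincare4.SmoothPoincare4.…` repeats a component
set_option linter.dupNamespace false

namespace Summit.SmoothPoincare4.SmoothPoincare4.Cruxes.TameOrBrodyR4.Sketch

/-- Local notation for the model space `ℝ⁴ = EuclideanSpace ℝ (Fin 4)`. -/
local notation "E4" => EuclideanSpace ℝ (Fin 4)

namespace Apriori

/-! ### Step α: one more derivative in `L²` -/

section Alpha

open MeasureTheory Metric

/-- **Step α for one word.** For a `C^∞` map `w : ℂ → ℝ⁴` (a word derivative of `g`) with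
`‖w‖ ≤ y`, source `‖∂₂w - A ∂₁w‖ ≤ C_s (1 + x² + y)` on the disc `‖z‖ ≤ ρ` containing the support
of the cut-off `χ`, `‖A‖ ≤ M₀` there, and frozen coefficients as in `energy_localized`:
`∫ ‖∂₁(χw)‖² + ‖∂₂(χw)‖² ≤ 4(1 + ‖A₀‖²)(6 C_s² (V + ∫_{D_ρ} x⁴ + ∫_{D_ρ} y²) + 2 C_χ² (1+M₀)² ∫_{D_ρ} y²)`. -/
theorem alpha_word
    (h1 : ∀ (A₀ : E4 →L[ℝ] E4), (∀ v, A₀ (A₀ v) = -v) → ∀ (W : ℂ → E4), ContDiff ℝ ∞ W →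
      HasCompactSupport W → (∫ z, (‖fderiv ℝ W z 1‖ ^ 2 + ‖fderiv ℝ W z Complex.I‖ ^ 2)) ≤
        (1 + ‖A₀‖ ^ 2) * ∫ z, ‖fderiv ℝ W z Complex.I - A₀ (fderiv ℝ W z 1)‖ ^ 2)
    (A₀ : E4 →L[ℝ] E4) (hA₀ : ∀ v, A₀ (A₀ v) = -v) (A : ℂ → E4 →L[ℝ] E4) (hA : Continuous A)
    (w : ℂ → E4) (hw : ContDiff ℝ ∞ w) (χ : ℂ → ℝ) (hχ : ContDiff ℝ ∞ χ)
    (hχc : HasCompactSupport χ) (ε : ℝ) (hε : 4 * (1 + ‖A₀‖ ^ 2) * ε ^ 2 ≤ 1)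
    (hAε : ∀ z ∈ tsupport χ, ‖A z - A₀‖ ≤ ε) {ρ Cχ M₀ Cs : ℝ} (hCs : 0 ≤ Cs) (hM₀ : 0 ≤ M₀)
    (hsupp : ∀ z ∈ tsupport χ, ‖z‖ ≤ ρ) (hχ1 : ∀ z, |χ z| ≤ 1)
    (hCχ : ∀ z v, ‖fderiv ℝ χ z v‖ ≤ Cχ * ‖v‖) (hAz : ∀ z : ℂ, ‖z‖ ≤ ρ → ‖A z‖ ≤ M₀)
    (x y : ℂ → ℝ) (hx : Continuous x) (hyc : Continuous y) (hy0 : ∀ z, 0 ≤ y z)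
    (hwy : ∀ z, ‖w z‖ ≤ y z)
    (hs : ∀ z : ℂ, ‖z‖ ≤ ρ → ‖fderiv ℝ w z Complex.I - A z (fderiv ℝ w z 1)‖ ≤
      Cs * (1 + x z ^ 2 + y z)) :
    (∫ z, (‖fderiv ℝ (fun t => χ t • w t) z 1‖ ^ 2 +
        ‖fderiv ℝ (fun t => χ t • w t) z Complex.I‖ ^ 2)) ≤
      4 * (1 + ‖A₀‖ ^ 2) * (6 * Cs ^ 2 * ((volume (closedBall (0 : ℂ) ρ)).toReal +
        (∫ z in closedBall (0 : ℂ) ρ, x z ^ 4) + ∫ z in closedBall (0 : ℂ) ρ, y z ^ 2) +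
        2 * Cχ ^ 2 * (1 + M₀) ^ 2 * ∫ z in closedBall (0 : ℂ) ρ, y z ^ 2) := by
  have hE := energy_localized h1 A₀ hA₀ A hA w hw χ hχ hχc ε hε hAε
  have hCχ0 : 0 ≤ Cχ := by
    have := hCχ 0 1
    rw [norm_one, mul_one] at this
    exact (norm_nonneg _).trans this
  -- the source `P` as an opaque function
  obtain ⟨P, hP⟩ : ∃ P : ℂ → E4, P = fun z => χ z • (fderiv ℝ w z Complex.I - A z (fderiv ℝ w z 1)) +
      fderiv ℝ χ z Complex.I • w z - fderiv ℝ χ z 1 • A z (w z) := ⟨_, rfl⟩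
  obtain ⟨F, hF⟩ : ∃ F : ℂ → ℝ, F = fun z => 6 * Cs ^ 2 * (1 + x z ^ 4 + y z ^ 2) +
      2 * Cχ ^ 2 * (1 + M₀) ^ 2 * y z ^ 2 := ⟨_, rfl⟩
  -- pointwise bound on the disc
  have hPF : ∀ z, ‖z‖ ≤ ρ → ‖P z‖ ^ 2 ≤ F z := by
    intro z hz
    have hd1 : ‖fderiv ℝ χ z 1‖ ≤ Cχ := by simpa using hCχ z 1
    have hdI : ‖fderiv ℝ χ z Complex.I‖ ≤ Cχ := by simpa using hCχ z Complex.I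
    have hAw : ‖A z (w z)‖ ≤ M₀ * y z :=
      (ContinuousLinearMap.le_opNorm _ _).trans (mul_le_mul (hAz z hz) (hwy z) (norm_nonneg _) hM₀)
    have hP1 : ‖P z‖ ≤ Cs * (1 + x z ^ 2 + y z) + Cχ * y z + Cχ * (M₀ * y z) := by
      have t1 : ‖χ z • (fderiv ℝ w z Complex.I - A z (fderiv ℝ w z 1))‖ ≤
          Cs * (1 + x z ^ 2 + y z) := by
        rw [norm_smul, Real.norm_eq_abs]
        have h0 : 0 ≤ Cs * (1 + x z ^ 2 + y z) := by have := hy0 z; positivity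
        calc |χ z| * ‖fderiv ℝ w z Complex.I - A z (fderiv ℝ w z 1)‖
            ≤ 1 * (Cs * (1 + x z ^ 2 + y z)) := mul_le_mul (hχ1 z) (hs z hz) (norm_nonneg _) zero_le_one
          _ = _ := one_mul _
      have t2 : ‖fderiv ℝ χ z Complex.I • w z‖ ≤ Cχ * y z := by
        rw [norm_smul]; exact mul_le_mul hdI (hwy z) (norm_nonneg _) hCχ0
      have t3 : ‖fderiv ℝ χ z 1 • A z (w z)‖ ≤ Cχ * (M₀ * y z) := by
        rw [norm_smul]; exact mul_le_mul hd1 hAw (norm_nonneg _) hCχ0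
      rw [hP]
      calc _ ≤ ‖χ z • (fderiv ℝ w z Complex.I - A z (fderiv ℝ w z 1))‖ +
            ‖fderiv ℝ χ z Complex.I • w z‖ + ‖fderiv ℝ χ z 1 • A z (w z)‖ :=
            norm_sub_le_of_le (norm_add_le _ _) le_rfl
        _ ≤ _ := by linarith
    rw [hF]
    exact sq_bound_aux (norm_nonneg _) hCs hCχ0 hM₀ (hy0 z) hP1
  -- `∫ ‖P‖² = ∫_{D_ρ} ‖P‖² ≤ ∫_{D_ρ} F`
  have hPzero : ∀ z, z ∉ closedBall (0 : ℂ) ρ → ‖P z‖ ^ 2 = 0 := by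
    intro z hz
    have hz' : z ∉ tsupport χ := fun h => hz (mem_closedBall_zero_iff.mpr (hsupp z h))
    have h0 : χ z = 0 := image_eq_zero_of_notMem_tsupport hz'
    have h0' : fderiv ℝ χ z = 0 := fderiv_eq_zero_of_notMem_tsupport hz'
    simp [hP, h0, h0']
  have hFc : Continuous F := by
    rw [hF]
    exact (continuous_const.mul ((continuous_const.add (hx.pow 4)).add (hyc.pow 2))).add
      (continuous_const.mul (hyc.pow 2))
  have hPc : Continuous fun z => ‖P z‖ ^ 2 := by
    have hcw : Continuous w := hw.continuous
    have hcw1 : Continuous fun z => fderiv ℝ w z 1 :=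
      (hw.continuous_fderiv (by simp)).clm_apply continuous_const
    have hcwI : Continuous fun z => fderiv ℝ w z Complex.I :=
      (hw.continuous_fderiv (by simp)).clm_apply continuous_const
    have hcχ1 : Continuous fun z => fderiv ℝ χ z 1 :=
      (hχ.continuous_fderiv (by simp)).clm_apply continuous_const
    have hcχI : Continuous fun z => fderiv ℝ χ z Complex.I :=
      (hχ.continuous_fderiv (by simp)).clm_apply continuous_const
    rw [hP]
    refine Continuous.pow (Continuous.norm ?_) 2
    exact ((hχ.continuous.smul (hcwI.sub (hA.clm_apply hcw1))).add (hcχI.smul hcw)).sub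
      (hcχ1.smul (hA.clm_apply hcw))
  have hPint : ∫ z, ‖P z‖ ^ 2 ≤ ∫ z in closedBall (0 : ℂ) ρ, F z := by
    rw [integral_eq_setIntegral_of_forall hPzero]
    refine setIntegral_mono_on (integrableOn_closedBall_of_continuous hPc 0 ρ)
      (integrableOn_closedBall_of_continuous hFc 0 ρ) measurableSet_closedBall fun z hz => ?_
    exact hPF z (mem_closedBall_zero_iff.mp hz)
  have hFint : ∫ z in closedBall (0 : ℂ) ρ, F z =
      6 * Cs ^ 2 * ((volume (closedBall (0 : ℂ) ρ)).toReal +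
        (∫ z in closedBall (0 : ℂ) ρ, x z ^ 4) + ∫ z in closedBall (0 : ℂ) ρ, y z ^ 2) +
        2 * Cχ ^ 2 * (1 + M₀) ^ 2 * ∫ z in closedBall (0 : ℂ) ρ, y z ^ 2 := by
    have i1 : IntegrableOn (fun _ : ℂ => (1 : ℝ)) (closedBall (0 : ℂ) ρ) :=
      integrableOn_closedBall_of_continuous continuous_const 0 ρ
    have i4 : IntegrableOn (fun z => x z ^ 4) (closedBall (0 : ℂ) ρ) :=
      integrableOn_closedBall_of_continuous (hx.pow 4) 0 ρ
    have i2 : IntegrableOn (fun z => y z ^ 2) (closedBall (0 : ℂ) ρ) :=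
      integrableOn_closedBall_of_continuous (hyc.pow 2) 0 ρ
    have hV : ∫ _ in closedBall (0 : ℂ) ρ, (1 : ℝ) = (volume (closedBall (0 : ℂ) ρ)).toReal := by
      rw [setIntegral_const, smul_eq_mul, mul_one]; rfl
    have iA : IntegrableOn (fun z => 6 * Cs ^ 2 * (1 + x z ^ 4 + y z ^ 2)) (closedBall (0 : ℂ) ρ) :=
      integrableOn_closedBall_of_continuous
        (continuous_const.mul ((continuous_const.add (hx.pow 4)).add (hyc.pow 2))) 0 ρ
    have iB : IntegrableOn (fun z => 2 * Cχ ^ 2 * (1 + M₀) ^ 2 * y z ^ 2) (closedBall (0 : ℂ) ρ) :=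
      integrableOn_closedBall_of_continuous (continuous_const.mul (hyc.pow 2)) 0 ρ
    have iC : IntegrableOn (fun z => 1 + x z ^ 4) (closedBall (0 : ℂ) ρ) :=
      integrableOn_closedBall_of_continuous (continuous_const.add (hx.pow 4)) 0 ρ
    rw [hF]
    beta_reduce
    rw [integral_add iA iB, integral_const_mul, integral_const_mul, integral_add iC i2,
      integral_add i1 i4, hV]
  have hmain : ∫ z, ‖P z‖ ^ 2 ≤ _ := hPint.trans (le_of_eq hFint)
  have hE' : (∫ z, (‖fderiv ℝ (fun t => χ t • w t) z 1‖ ^ 2 +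
      ‖fderiv ℝ (fun t => χ t • w t) z Complex.I‖ ^ 2)) ≤ 4 * (1 + ‖A₀‖ ^ 2) * ∫ z, ‖P z‖ ^ 2 := by
    rw [hP]; exact hE
  exact hE'.trans (mul_le_mul_of_nonneg_left hmain (by positivity))

/-- **Step α (one more derivative in `L²`).** With the orders `1 ≤ i ≤ n - 2` frozen on the disc
of radius `ρ` (`ρ` so small that `J ∘ g` is `ε`-close to `J(g 0)` with `4(1 + M₀²)ε² ≤ 1`):
`∫_{D_{ρ'}} ‖D^{n+1}g‖² ≤ C (1 + ∫_{D_ρ} ‖D^{n-1}g‖⁴ + ∫_{D_ρ} ‖Dⁿg‖²)` with `C` independent of `g`. -/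
theorem alpha
    (h1 : ∀ (A₀ : E4 →L[ℝ] E4), (∀ v, A₀ (A₀ v) = -v) → ∀ (W : ℂ → E4), ContDiff ℝ ∞ W →
      HasCompactSupport W → (∫ z, (‖fderiv ℝ W z 1‖ ^ 2 + ‖fderiv ℝ W z Complex.I‖ ^ 2)) ≤
        (1 + ‖A₀‖ ^ 2) * ∫ z, ‖fderiv ℝ W z Complex.I - A₀ (fderiv ℝ W z 1)‖ ^ 2)
    (hB : ∀ (n : ℕ) (T : ContinuousMultilinearMap ℝ (fun _ : Fin n => ℂ) E4),
      ‖T‖ ≤ ∑ L : Fin n → Fin 2, ‖T (fun j => ![(1 : ℂ), Complex.I] (L j))‖)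
    {J : E4 → E4 →L[ℝ] E4} (hJs : ContDiff ℝ ∞ J) (hJ2 : ∀ x v, J x (J x v) = -v)
    {R₀ M₀ M₁ : ℝ} (hM₀ : ∀ x : E4, ‖x‖ ≤ R₀ → ‖J x‖ ≤ M₀)
    (hM₁ : ∀ x : E4, ‖x‖ ≤ R₀ → ‖fderiv ℝ J x‖ ≤ M₁)
    {n : ℕ} (hn : 1 ≤ n) {ρ' ρ : ℝ} (hρ' : 0 < ρ') (hρ'ρ : ρ' < ρ) (hρ1 : ρ ≤ 1)
    (hρδ : 16 * (1 + M₀ ^ 2) * M₁ ^ 2 * ρ ^ 2 ≤ 1) (S : ℝ) :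
    ∃ C : ℝ, ∀ g : ℂ → E4, ContDiff ℝ ∞ g → IsJHolomorphicFlat J g →
      (∀ z : ℂ, ‖z‖ ≤ 1 → ‖g z‖ ≤ R₀) → (∀ z : ℂ, ‖z‖ ≤ 1 → ‖fderiv ℝ g z‖ ≤ 2) →
      (∀ i, 1 ≤ i → i + 2 ≤ n → ∀ z : ℂ, ‖z‖ ≤ ρ → ‖iteratedFDeriv ℝ i g z‖ ≤ S) →
      ∫ z in closedBall (0 : ℂ) ρ', ‖iteratedFDeriv ℝ (n + 1) g z‖ ^ 2 ≤
        C * (1 + (∫ z in closedBall (0 : ℂ) ρ, ‖iteratedFDeriv ℝ (n - 1) g z‖ ^ 4) +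
          ∫ z in closedBall (0 : ℂ) ρ, ‖iteratedFDeriv ℝ n g z‖ ^ 2) := by
  -- degenerate case `R₀ < 0`: the hypotheses on `g` are contradictory
  rcases lt_or_ge R₀ 0 with hR | hR
  · refine ⟨0, fun g _ _ hg0 _ _ => ?_⟩
    exact absurd ((norm_nonneg (g 0)).trans (hg0 0 (by simp))) (not_le.mpr hR)
  -- constants independent of `g`
  obtain ⟨M, hM⟩ := exists_bound_iteratedFDeriv hJs R₀ n
  have hM0 : 0 ≤ M := (norm_nonneg _).trans (hM 0 (Nat.zero_le _) 0 (by simpa using hR))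
  have hS' : (2 : ℝ) ≤ max S 2 := le_max_right _ _
  have hS'0 : (0 : ℝ) ≤ max S 2 := zero_le_two.trans hS'
  obtain ⟨Cs, hCs_def⟩ : ∃ Cs : ℝ, Cs = ∑ j ∈ Finset.range n, (n.choose (j + 1) : ℝ) * (j + 1)! * M *
      ((max S 2) ^ (j + 1) + 1 + (max S 2) ^ 2 + max S 2) * (2 * max S 2) := ⟨_, rfl⟩
  have hCs : 0 ≤ Cs := by rw [hCs_def]; exact srcConst_nonneg n hM0 hS'0
  let χ : ContDiffBump (0 : ℂ) := ⟨(2 * ρ' + ρ) / 3, (ρ' + 2 * ρ) / 3, by linarith, by linarith⟩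
  have hχIn : ρ' < χ.rIn := by show ρ' < (2 * ρ' + ρ) / 3; linarith
  have hχOut : χ.rOut < ρ := by show (ρ' + 2 * ρ) / 3 < ρ; linarith
  have hχc : ContDiff ℝ ∞ (χ : ℂ → ℝ) := χ.contDiff
  have hχs : HasCompactSupport (χ : ℂ → ℝ) := χ.hasCompactSupport
  obtain ⟨Cχ, hCχ⟩ : ∃ C, ∀ z, ‖fderiv ℝ (χ : ℂ → ℝ) z‖ ≤ C :=
    (hχs.fderiv (𝕜 := ℝ)).exists_bound_of_continuous (hχc.continuous_fderiv (by simp))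
  have hCχ0 : 0 ≤ Cχ := (norm_nonneg _).trans (hCχ 0)
  have hCχv : ∀ z v, ‖fderiv ℝ (χ : ℂ → ℝ) z v‖ ≤ Cχ * ‖v‖ := fun z v =>
    (ContinuousLinearMap.le_opNorm _ _).trans (mul_le_mul_of_nonneg_right (hCχ z) (norm_nonneg _))
  have hχ1 : ∀ z, |(χ : ℂ → ℝ) z| ≤ 1 := fun z => by
    rw [abs_of_nonneg χ.nonneg]; exact χ.le_one
  have hsuppχ : ∀ z ∈ tsupport (χ : ℂ → ℝ), ‖z‖ ≤ ρ := by
    intro z hz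
    rw [χ.tsupport_eq] at hz
    exact (mem_closedBall_zero_iff.mp hz).trans hχOut.le
  obtain ⟨V, hV⟩ : ∃ V : ℝ, V = (volume (closedBall (0 : ℂ) ρ)).toReal := ⟨_, rfl⟩
  have hV0 : 0 ≤ V := by rw [hV]; exact ENNReal.toReal_nonneg
  have hM₀0 : 0 ≤ M₀ := (norm_nonneg _).trans (hM₀ 0 (by simpa using hR))
  obtain ⟨K, hK⟩ : ∃ K : ℝ, K = 4 * (1 + M₀ ^ 2) * (6 * Cs ^ 2 * (V + 1) +
      2 * Cχ ^ 2 * (1 + M₀) ^ 2) := ⟨_, rfl⟩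
  have hK0 : 0 ≤ K := by rw [hK]; positivity
  refine ⟨(2 : ℝ) ^ (n + 1) * 2 ^ (n + 1) * K, fun g hg hgJ hg0 hg1 hlow => ?_⟩
  -- abbreviations for the fixed map `g`
  have hac : ∀ k, Continuous fun z => ‖iteratedFDeriv ℝ k g z‖ := fun k =>
    (hg.continuous_iteratedFDeriv (m := k) (by exact_mod_cast le_top)).norm
  have hA : Continuous fun z => J (g z) := hJs.continuous.comp hg.continuous
  have hA₀2 : ∀ v, J (g 0) (J (g 0) v) = -v := hJ2 (g 0)
  have hA₀n : ‖J (g 0)‖ ≤ M₀ := hM₀ _ (hg0 0 (by simp))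
  have hAz : ∀ z : ℂ, ‖z‖ ≤ ρ → ‖J (g z)‖ ≤ M₀ := fun z hz => hM₀ _ (hg0 z (hz.trans hρ1))
  -- freezing: `‖J(g z) - J(g 0)‖ ≤ ε := 2 M₁ ρ` on the support of `χ`
  have hM₁0 : 0 ≤ M₁ := (norm_nonneg (fderiv ℝ J (g 0))).trans (hM₁ _ (hg0 0 (by simp)))
  have hρ0 : 0 ≤ ρ := by linarith
  have hε : 4 * (1 + ‖J (g 0)‖ ^ 2) * (2 * M₁ * ρ) ^ 2 ≤ 1 := by
    have h' : ‖J (g 0)‖ ^ 2 ≤ M₀ ^ 2 := pow_le_pow_left₀ (norm_nonneg _) hA₀n 2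
    have : 4 * (1 + ‖J (g 0)‖ ^ 2) * (2 * M₁ * ρ) ^ 2 ≤ 4 * (1 + M₀ ^ 2) * (2 * M₁ * ρ) ^ 2 := by
      apply mul_le_mul_of_nonneg_right _ (sq_nonneg _); linarith
    nlinarith
  have hAε : ∀ z ∈ tsupport (χ : ℂ → ℝ), ‖J (g z) - J (g 0)‖ ≤ 2 * M₁ * ρ := by
    intro z hz
    have hzρ := hsuppχ z hz
    have hz1 : ‖z‖ ≤ 1 := hzρ.trans hρ1
    have hgz : ‖g z - g 0‖ ≤ 2 * ‖z - 0‖ :=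
      (convex_closedBall (0 : ℂ) 1).norm_image_sub_le_of_norm_fderiv_le
        (fun x _ => (hg.differentiable (by simp)) x)
        (fun x hx => hg1 x (mem_closedBall_zero_iff.mp hx))
        (by simp) (mem_closedBall_zero_iff.mpr hz1)
    have hJz : ‖J (g z) - J (g 0)‖ ≤ M₁ * ‖g z - g 0‖ :=
      (convex_closedBall (0 : E4) R₀).norm_image_sub_le_of_norm_fderiv_le
        (fun x _ => (hJs.differentiable (by simp)) x)
        (fun x hx => hM₁ x (mem_closedBall_zero_iff.mp hx))
        (mem_closedBall_zero_iff.mpr (hg0 0 (by simp))) (mem_closedBall_zero_iff.mpr (hg0 z hz1))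
    rw [sub_zero] at hgz
    calc ‖J (g z) - J (g 0)‖ ≤ M₁ * (2 * ‖z‖) := hJz.trans (mul_le_mul_of_nonneg_left hgz hM₁0)
      _ ≤ M₁ * (2 * ρ) := by gcongr
      _ = 2 * M₁ * ρ := by ring
  -- integrals on the big disc
  obtain ⟨I4, hI4⟩ : ∃ I4 : ℝ, I4 = ∫ z in closedBall (0 : ℂ) ρ, ‖iteratedFDeriv ℝ (n - 1) g z‖ ^ 4 :=
    ⟨_, rfl⟩
  obtain ⟨I2, hI2⟩ : ∃ I2 : ℝ, I2 = ∫ z in closedBall (0 : ℂ) ρ, ‖iteratedFDeriv ℝ n g z‖ ^ 2 :=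
    ⟨_, rfl⟩
  have hI40 : 0 ≤ I4 := by rw [hI4]; exact integral_nonneg fun z => by positivity
  have hI20 : 0 ≤ I2 := by rw [hI2]; exact integral_nonneg fun z => by positivity
  rw [← hI4, ← hI2]
  -- the localized energy bound for every word of length `n`
  have key : ∀ L : Fin n → Fin 2,
      (∫ z, (‖fderiv ℝ (fun t => χ t • iteratedFDeriv ℝ n g t (fun j => ![(1 : ℂ), Complex.I] (L j))) z 1‖ ^ 2 +
        ‖fderiv ℝ (fun t => χ t • iteratedFDeriv ℝ n g t (fun j => ![(1 : ℂ), Complex.I] (L j))) z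
          Complex.I‖ ^ 2)) ≤ K * (1 + I4 + I2) := by
    intro L
    have hw : ContDiff ℝ ∞ (iteratedFDeriv ℝ n g · (fun j => ![(1 : ℂ), Complex.I] (L j))) :=
      contDiff_iteratedFDeriv_apply hg n _
    have hs : ∀ z : ℂ, ‖z‖ ≤ ρ →
        ‖fderiv ℝ (iteratedFDeriv ℝ n g · (fun j => ![(1 : ℂ), Complex.I] (L j))) z Complex.I -
          J (g z) (fderiv ℝ (iteratedFDeriv ℝ n g · (fun j => ![(1 : ℂ), Complex.I] (L j))) z 1)‖ ≤
        Cs * (1 + ‖iteratedFDeriv ℝ (n - 1) g z‖ ^ 2 + ‖iteratedFDeriv ℝ n g z‖) := by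
      intro z hz
      have hz1 : ‖z‖ ≤ 1 := hz.trans hρ1
      rw [hCs_def]
      exact source_pointwise hJs hg hgJ hn hS' L z (fun i hi => hM i hi _ (hg0 z hz1)) (hg1 z hz1)
        (fun i hi1 hi2 => (hlow i hi1 hi2 z hz).trans (le_max_left _ _))
    have hword := alpha_word h1 (J (g 0)) hA₀2 (fun z => J (g z)) hA _ hw χ hχc hχs (2 * M₁ * ρ) hε hAε
      hCs hM₀0 hsuppχ hχ1 hCχv hAz (fun z => ‖iteratedFDeriv ℝ (n - 1) g z‖)
      (fun z => ‖iteratedFDeriv ℝ n g z‖) (hac _) (hac _) (fun z => norm_nonneg _)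
      (fun z => norm_iteratedFDeriv_apply_basis_le g n L z) hs
    rw [← hV, ← hI4, ← hI2] at hword
    rw [hK]
    exact hword.trans (alpha_const_compare (norm_nonneg _) hA₀n hV0 hI40 hI20)
  -- the left-hand side: `a_{n+1}² ≤ 2^{n+1} ∑_{L'} (‖∂₁(χ w_{tail L'})‖² + ‖∂₂(χ w_{tail L'})‖²)` on the small disc
  have hLHS : ∀ z ∈ closedBall (0 : ℂ) ρ', ‖iteratedFDeriv ℝ (n + 1) g z‖ ^ 2 ≤ (2 : ℝ) ^ (n + 1) *
      ∑ L' : Fin (n + 1) → Fin 2,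
        (‖fderiv ℝ (fun t => χ t • iteratedFDeriv ℝ n g t (fun j => ![(1 : ℂ), Complex.I] (Fin.tail L' j))) z 1‖ ^ 2 +
         ‖fderiv ℝ (fun t => χ t • iteratedFDeriv ℝ n g t (fun j => ![(1 : ℂ), Complex.I] (Fin.tail L' j))) z
           Complex.I‖ ^ 2) := by
    intro z hz
    have hzIn : z ∈ ball (0 : ℂ) χ.rIn :=
      mem_ball_zero_iff.mpr ((mem_closedBall_zero_iff.mp hz).trans_lt hχIn)
    refine (sq_norm_le_of_basis hB (n + 1) (iteratedFDeriv ℝ (n + 1) g z)).trans ?_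
    refine mul_le_mul_of_nonneg_left (Finset.sum_le_sum fun L' _ => ?_) (pow_nonneg zero_le_two _)
    have hsucc := iteratedFDeriv_succ_apply_eq_fderiv hg n (fun j => ![(1 : ℂ), Complex.I] (L' j)) z
    have htail : (Fin.tail fun j => (![(1 : ℂ), Complex.I] : Fin 2 → ℂ) (L' j)) =
        fun j => ![(1 : ℂ), Complex.I] (Fin.tail L' j) := rfl
    rw [htail] at hsucc
    rw [hsucc, ← fderiv_smul_eq_of_mem
      (w := (iteratedFDeriv ℝ n g · (fun j => ![(1 : ℂ), Complex.I] (Fin.tail L' j)))) hzIn]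
    rcases Fin.eq_zero_or_eq_succ (L' 0) with h0 | ⟨j, hj⟩
    · simp only [h0, Matrix.cons_val_zero]
      exact le_add_of_nonneg_right (sq_nonneg _)
    · simp only [hj, Fin.eq_zero j, Matrix.cons_val_succ, Matrix.cons_val_zero]
      exact le_add_of_nonneg_left (sq_nonneg _)
  -- integrability of the localized energy densities
  have hG_int : ∀ L' : Fin (n + 1) → Fin 2, Integrable (fun z =>
      ‖fderiv ℝ (fun t => χ t • iteratedFDeriv ℝ n g t (fun j => ![(1 : ℂ), Complex.I] (Fin.tail L' j))) z 1‖ ^ 2 +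
      ‖fderiv ℝ (fun t => χ t • iteratedFDeriv ℝ n g t (fun j => ![(1 : ℂ), Complex.I] (Fin.tail L' j))) z
        Complex.I‖ ^ 2) := by
    intro L'
    have hW : ContDiff ℝ ∞ (fun t => χ t • iteratedFDeriv ℝ n g t (fun j => ![(1 : ℂ), Complex.I] (Fin.tail L' j))) :=
      hχc.smul (contDiff_iteratedFDeriv_apply hg n _)
    have hWc : HasCompactSupport
        (fun t => χ t • iteratedFDeriv ℝ n g t (fun j => ![(1 : ℂ), Complex.I] (Fin.tail L' j))) :=
      hχs.smul_right
    have hc1 := (hW.continuous_fderiv (by simp)).clm_apply (continuous_const (y := (1 : ℂ)))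
    have hcI := (hW.continuous_fderiv (by simp)).clm_apply (continuous_const (y := Complex.I))
    refine ((hc1.norm.pow 2).add (hcI.norm.pow 2)).integrable_of_hasCompactSupport ?_
    exact hasCompactSupport_of_eq_zero hWc fun z hz => by
      simp [fderiv_eq_zero_of_notMem_tsupport hz]
  have hcard : ((Finset.univ : Finset (Fin (n + 1) → Fin 2)).card : ℝ) = 2 ^ (n + 1) := by simp
  calc ∫ z in closedBall (0 : ℂ) ρ', ‖iteratedFDeriv ℝ (n + 1) g z‖ ^ 2
      ≤ ∫ z in closedBall (0 : ℂ) ρ', (2 : ℝ) ^ (n + 1) * ∑ L' : Fin (n + 1) → Fin 2,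
          (‖fderiv ℝ (fun t => χ t • iteratedFDeriv ℝ n g t (fun j => ![(1 : ℂ), Complex.I] (Fin.tail L' j))) z 1‖ ^ 2 +
           ‖fderiv ℝ (fun t => χ t • iteratedFDeriv ℝ n g t (fun j => ![(1 : ℂ), Complex.I] (Fin.tail L' j))) z
             Complex.I‖ ^ 2) := by
        refine setIntegral_mono_on (integrableOn_closedBall_of_continuous ((hac _).pow 2) 0 ρ') ?_
          measurableSet_closedBall hLHS
        exact ((integrable_finsetSum _ fun L' _ => hG_int L').const_mul _).integrableOn
    _ = (2 : ℝ) ^ (n + 1) * ∑ L' : Fin (n + 1) → Fin 2, ∫ z in closedBall (0 : ℂ) ρ',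
          (‖fderiv ℝ (fun t => χ t • iteratedFDeriv ℝ n g t (fun j => ![(1 : ℂ), Complex.I] (Fin.tail L' j))) z 1‖ ^ 2 +
           ‖fderiv ℝ (fun t => χ t • iteratedFDeriv ℝ n g t (fun j => ![(1 : ℂ), Complex.I] (Fin.tail L' j))) z
             Complex.I‖ ^ 2) := by
        rw [integral_const_mul, integral_finsetSum _ fun L' _ => (hG_int L').integrableOn]
    _ ≤ (2 : ℝ) ^ (n + 1) * ∑ L' : Fin (n + 1) → Fin 2, K * (1 + I4 + I2) := by
        refine mul_le_mul_of_nonneg_left (Finset.sum_le_sum fun L' _ => ?_) (pow_nonneg zero_le_two _)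
        exact (setIntegral_le_integral (hG_int L') (Filter.Eventually.of_forall fun z =>
          add_nonneg (sq_nonneg _) (sq_nonneg _))).trans (key (Fin.tail L'))
    _ = (2 : ℝ) ^ (n + 1) * 2 ^ (n + 1) * K * (1 + I4 + I2) := by
        rw [Finset.sum_const, Finset.card_univ, ← Finset.card_univ, nsmul_eq_mul, hcard]; ring

end Alpha

end Apriori

end Summit.SmoothPoincare4.SmoothPoincare4.Cruxes.TameOrBrodyR4.Sketch
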